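import Summits.AtomisticToContinuum.Crystallization.Theorems.TransitiveLocalLimit.Negative.UniformFloor

/-!
# Negative knowledge for crux `PerronTransitivity.TransitiveLocalLimit` (stmt-AtomisticToContinuum-15100), IV:
# every FINITE configuration is excluded — the transitive limit is infinite

Refuter vetting (cdisprove, `--supports stmt-AtomisticToContinuum-15100`).  Small-model exclusion for all `n` at
once (the sibling file `UniformBindingRigidity.Negative.LoadBearing` did `n = 1`):

* `card_mul_eStar_lt` — the STRICT finite floor `N·E* < E_LJ(y)` for every injective `y`, `N ≥ 1`: two far-apart
  copies of `y` attract strictly (`V_LJ < 0` beyond distance `1`), while the doubled configuration still obeys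
  `2N·E* ≤ E` (`card_mul_eStar_le`).
* `two_mul_card_mul_eStar_lt` — `Finset` form: `2·#F·E* < Σ_{p ∈ F} Σ_{q ∈ F∖p} V_LJ(dist p q)` (`F ≠ ∅`).
* `finite_not_uniformly_bound` — **no finite non-empty `X ⊆ ℝ³` has `U_X(p) ≤ 2E*` at every site**; hence
  `finite_not_transitive` (no finite `X` has `U_X ≡ 2E*`) and `infinite_of_transitive`: the `X` produced by the
  crux is necessarily INFINITE (and every finite cluster — dimer, icosahedron, Mackay shells, … — is excluded from
  M*'s hypothesis as well, not only the singleton).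
All `[folklore]`.
-/

noncomputable section

namespace Summit.AtomisticToContinuum.Crystallization.Theorems.TransitiveLocalLimit.Negative.FiniteExcluded

open Literature.MathematicalPhysics.StatisticalMechanics
open Summit.AtomisticToContinuum.Crystallization.Theorems.ChargedEnergyGapNegative (E3 eStar card_mul_eStar_le)
open Summit.AtomisticToContinuum.Crystallization.Theorems.HullBulkOptimal (tsum_finite_eq_sum)

/-! ## The strict finite floor -/

/-- **`N·E* < E_LJ(y)`** for every injective configuration `y` of `N ≥ 1` points of `ℝ³`: a far translate
`y + c` of `y` gives an injective configuration of `2N` points with energy `2E(y) + (cross terms)`, the cross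
terms are `< 0` (all cross distances `> 1`, `lennardJones_neg`), and `2N·E* ≤` that energy. [folklore] -/
theorem card_mul_eStar_lt {N : ℕ} (hN : 0 < N) {y : Fin N → EuclideanSpace ℝ (Fin 3)}
    (hy : Function.Injective y) : (N : ℝ) * eStar < interactionEnergy lennardJones y := by
  set R : ℝ := 2 + ∑ i, ‖y i‖ + ∑ j, ‖y j‖ with hR
  set c : EuclideanSpace ℝ (Fin 3) := EuclideanSpace.single (0 : Fin 3) R with hc_def
  have hR0 : 0 ≤ R :=
    add_nonneg (add_nonneg zero_le_two (Finset.sum_nonneg fun _ _ => norm_nonneg _))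
      (Finset.sum_nonneg fun _ _ => norm_nonneg _)
  have hcn : ‖c‖ = R := by simp [hc_def, abs_of_nonneg hR0]
  set z' : Fin N → EuclideanSpace ℝ (Fin 3) := fun j => y j + c with hz'
  have hfar : ∀ i j, 1 < dist (y i) (z' j) := fun i j => by
    have hyi : ‖y i‖ ≤ ∑ i', ‖y i'‖ :=
      Finset.single_le_sum (f := fun i' => ‖y i'‖) (fun _ _ => norm_nonneg _) (Finset.mem_univ i)
    have hzj : ‖y j‖ ≤ ∑ j', ‖y j'‖ :=
      Finset.single_le_sum (f := fun j' => ‖y j'‖) (fun _ _ => norm_nonneg _) (Finset.mem_univ j)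
    have h1 : ‖c‖ - ‖y i - y j‖ ≤ dist (y i) (z' j) := by
      rw [dist_comm, dist_eq_norm]
      have e : c - (z' j - y i) = y i - y j := by simp only [hz']; abel
      have := norm_sub_norm_le c (z' j - y i)
      rw [e] at this
      linarith
    have h2 : ‖y i - y j‖ ≤ ‖y i‖ + ‖y j‖ := norm_sub_le _ _
    linarith
  have hne : ∀ i j, y i ≠ z' j := fun i j h => by
    have := hfar i j
    rw [h, dist_self] at this
    norm_num at this
  have hz'inj : Function.Injective z' := fun a b hab => hy (add_right_cancel hab)
  set w : Fin (N + N) → EuclideanSpace ℝ (Fin 3) := Fin.append y z' with hw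
  have hinj : Function.Injective w := by
    intro a b hab
    induction a using Fin.addCases with
    | left a =>
      induction b using Fin.addCases with
      | left b =>
        simp only [hw, Fin.append_left] at hab
        rw [hy hab]
      | right b =>
        simp only [hw, Fin.append_left, Fin.append_right] at hab
        exact absurd hab (hne a b)
    | right a =>
      induction b using Fin.addCases with
      | left b =>
        simp only [hw, Fin.append_left, Fin.append_right] at hab
        exact absurd hab.symm (hne b a)
      | right b =>
        simp only [hw, Fin.append_right] at hab
        rw [hz'inj hab]
  have hle : ((N + N : ℕ) : ℝ) * eStar ≤ interactionEnergy lennardJones w := card_mul_eStar_le hinj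
  have hdec := interactionEnergy_append lennardJones lennardJones_zero y z'
  have hz'E : interactionEnergy lennardJones z' = interactionEnergy lennardJones y :=
    interactionEnergy_add_const lennardJones y c
  have hneg : ∑ i, ∑ j, lennardJones (dist (y i) (z' j)) < 0 := by
    have hKne : (Finset.univ : Finset (Fin N)).Nonempty := ⟨⟨0, hN⟩, Finset.mem_univ _⟩
    exact Finset.sum_neg (fun i _ => Finset.sum_neg (fun j _ => lennardJones_neg (hfar i j)) hKne) hKne
  rw [hw] at hle
  rw [hdec, hz'E] at hle
  push_cast at hle
  linarith

/-- `Finset` form of the strict floor: `2·#F·E* < Σ_{p ∈ F} Σ_{q ∈ F ∖ {p}} V_LJ(dist p q)` for every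
non-empty finite `F ⊆ ℝ³`. [folklore] -/
theorem two_mul_card_mul_eStar_lt (F : Finset E3) (hF : F.Nonempty) :
    2 * ((F.card : ℝ) * eStar) < ∑ p ∈ F, ∑ q ∈ F.erase p, lennardJones (dist p q) := by
  classical
  set e := F.equivFin
  set y : Fin F.card → E3 := fun i => ((e.symm i : {x // x ∈ F}) : E3) with hy_def
  have hy : Function.Injective y := fun i j h => e.symm.injective (Subtype.ext h)
  have h1 := card_mul_eStar_lt hF.card_pos hy
  have h2 := two_mul_interactionEnergy_eq_sum_sum lennardJones lennardJones_zero y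
  have inner : ∀ p : E3, ∑ k, lennardJones (dist p (y k)) = ∑ q ∈ F, lennardJones (dist p q) := fun p => by
    calc ∑ k, lennardJones (dist p (y k))
        = ∑ a : {x // x ∈ F}, lennardJones (dist p (a : E3)) :=
          Equiv.sum_comp e.symm (fun a : {x // x ∈ F} => lennardJones (dist p (a : E3)))
      _ = ∑ q ∈ F, lennardJones (dist p q) := Finset.sum_coe_sort F (fun q => lennardJones (dist p q))
  have h3 : ∑ i, ∑ k, lennardJones (dist (y i) (y k)) = ∑ p ∈ F, ∑ q ∈ F, lennardJones (dist p q) := by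
    simp_rw [inner]
    calc ∑ i, ∑ q ∈ F, lennardJones (dist (y i) q)
        = ∑ a : {x // x ∈ F}, ∑ q ∈ F, lennardJones (dist (a : E3) q) :=
          Equiv.sum_comp e.symm (fun a : {x // x ∈ F} => ∑ q ∈ F, lennardJones (dist (a : E3) q))
      _ = ∑ p ∈ F, ∑ q ∈ F, lennardJones (dist p q) :=
          Finset.sum_coe_sort F (fun p => ∑ q ∈ F, lennardJones (dist p q))
  have h4 : ∑ p ∈ F, ∑ q ∈ F.erase p, lennardJones (dist p q) = ∑ p ∈ F, ∑ q ∈ F, lennardJones (dist p q) := by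
    refine Finset.sum_congr rfl fun p hp => ?_
    rw [← Finset.add_sum_erase F _ hp, dist_self, lennardJones_zero, zero_add]
  linarith [h1, h2, h3, h4]

/-! ## Finite configurations are excluded -/

/-- The site `tsum` of a finite `X` at `p ∈ X` is the finite sum over `X ∖ {p}`. [folklore] -/
theorem tsum_site_eq_sum_erase {X : Set E3} (hX : X.Finite) (p : E3) :
    ∑' q : {q : E3 // q ∈ X ∧ q ≠ p}, lennardJones (dist p q.1) =
      ∑ q ∈ hX.toFinset.erase p, lennardJones (dist p q) := by
  classical
  set A : Set E3 := {q : E3 | q ∈ X ∧ q ≠ p} with hA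
  have hAfin : A.Finite := hX.subset fun q hq => hq.1
  have h0 : (∑' q : {q : E3 // q ∈ X ∧ q ≠ p}, lennardJones (dist p q.1)) =
      ∑' q : A, (fun q : E3 => lennardJones (dist p q)) q := rfl
  rw [h0, tsum_finite_eq_sum hAfin (fun q : E3 => lennardJones (dist p q))]
  refine Finset.sum_congr ?_ fun _ _ => rfl
  ext q
  simp only [Set.Finite.mem_toFinset, Finset.mem_erase, hA, Set.mem_setOf_eq]
  tauto

/-- **No finite non-empty `X ⊆ ℝ³` is uniformly `2E*`-bound**: summing `U_X(p) ≤ 2E*` over `p ∈ X` contradicts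
the strict floor. [folklore] -/
theorem finite_not_uniformly_bound {X : Set (EuclideanSpace ℝ (Fin 3))} (hX : X.Finite) (hne : X.Nonempty) :
    ¬ ∀ p ∈ X, ∑' q : {q : EuclideanSpace ℝ (Fin 3) // q ∈ X ∧ q ≠ p}, lennardJones (dist p q.1) ≤
        2 * ⨅ Q : PeriodicConfiguration 3, Q.energyPerParticle lennardJones := by
  intro h
  change ∀ p ∈ X, _ ≤ 2 * eStar at h
  set F := hX.toFinset with hF
  have hFne : F.Nonempty := by
    obtain ⟨p, hp⟩ := hne
    exact ⟨p, hX.mem_toFinset.2 hp⟩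
  have key : ∀ p ∈ F, ∑ q ∈ F.erase p, lennardJones (dist p q) ≤ 2 * eStar := fun p hp => by
    rw [← tsum_site_eq_sum_erase hX p]
    exact h p (hX.mem_toFinset.1 hp)
  have hsum := Finset.sum_le_sum key
  rw [Finset.sum_const, nsmul_eq_mul] at hsum
  have hlt := two_mul_card_mul_eStar_lt F hFne
  linarith

/-- **No finite `X` is energy-transitive at `2E*`**. [folklore] -/
theorem finite_not_transitive {X : Set (EuclideanSpace ℝ (Fin 3))} (hX : X.Finite) (hne : X.Nonempty) :
    ¬ ∀ p ∈ X, ∑' q : {q : EuclideanSpace ℝ (Fin 3) // q ∈ X ∧ q ≠ p}, lennardJones (dist p q.1) =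
        2 * ⨅ Q : PeriodicConfiguration 3, Q.energyPerParticle lennardJones :=
  fun h => finite_not_uniformly_bound hX hne fun p hp => (h p hp).le

/-- **The transitive limit is infinite**: an `X` as in the conclusion of the crux (non-empty, every site bound at
exactly `2E*`) is an infinite set. [folklore] -/
theorem infinite_of_transitive {X : Set (EuclideanSpace ℝ (Fin 3))} (hne : X.Nonempty)
    (hU : ∀ p ∈ X, ∑' q : {q : EuclideanSpace ℝ (Fin 3) // q ∈ X ∧ q ≠ p}, lennardJones (dist p q.1) =
        2 * ⨅ Q : PeriodicConfiguration 3, Q.energyPerParticle lennardJones) : X.Infinite :=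
  fun hX => finite_not_transitive hX hne hU

end Summit.AtomisticToContinuum.Crystallization.Theorems.TransitiveLocalLimit.Negative.FiniteExcluded

end
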